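import Literature.Analysis.ODE.PathDrivenVariationBound
import HarnessLib

/-!
# Path-driven ODEs: the first-variation (jet) system and second-order derivative bounds

Topic `Literature/Analysis/ODE`. Sequel to `PathDrivenSmoothDependence.lean` /
`PathDrivenVariationBound.lean` (path-driven equation `v(τ) = x + ∫₀^τ G(c(s), v(s)) ds` on
`I = [0, 1]`, `c` merely continuous, solution family `Φ x`, equation of variation, Grönwall bound
`‖DΦ(x) δ‖ ≤ ‖δ‖ e^{Aτ}`). Classical device for HIGHER derivatives (Hartman, *ODE*, Ch. V, Thm. 3.1
and its proof, Cor. 4.1): the pair (solution, first variation) solves an enlarged system of the same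
type, to which the first-order theorem applies again.
* `jet_solution_family` — `Φ₁(x, δ) = (Φ x, DΦ(x) δ)` is THE solution family of the path-driven
  system with field `G₁(p, (v, w)) = (G(p, v), ∂_vG(p, v) w)` (uniqueness of the linear second
  component by Grönwall); `contDiff_jet_solution_family` — it is `C^n` when `G` is `C^{n+1}`;
* `norm_fderiv_jet_solution_family_eval_le` — Grönwall for the jet: if along the solution
  `‖∂_vG‖ ≤ A₁`, `‖∂²_{vv}G‖ ≤ A₂`, then `‖D_{(x,δ)}(Φ₁(·)(τ))(x₀, δ₀)‖ ≤ exp((A₁ + A₂‖δ₀‖e^{A₁}) τ)`;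
* `norm_fderiv_fderiv_pathDriven_le` — **second derivative of the flow**:
  `‖D²(x ↦ Φ x τ)(x₀)‖ ≤ exp((A₁ + A₂ e^{A₁}) τ)`, depending only on derivative bounds of the field
  along the solution, NOT on the driving path (input for differentiating twice under an expectation
  over rough driving paths).
Everything is PROVED; no definitions, no named facts.

## References
* P. Hartman, *Ordinary Differential Equations*, SIAM Classics 38 (2002), Ch. V, Thm. 3.1 (PDF p. 95),
  Cor. 4.1 (PDF p. 100), Ch. IV Lemma 4.1. [Hartman2002]
-/

noncomputable section

open Set Metric Filter Topology Function unitInterval MeasureTheory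
open scoped ContDiff NNReal

namespace Literature.Analysis.ODE

universe u

section Jet

variable {P : Type u} [NormedAddCommGroup P] [NormedSpace ℝ P] [CompleteSpace P]
  {E : Type u} [NormedAddCommGroup E] [NormedSpace ℝ E] [CompleteSpace E]

/-! ### The jet field `G₁(p, (v, w)) = (G(p, v), ∂_vG(p, v) w)` -/

omit [CompleteSpace P] [CompleteSpace E] in
/-- The jet field of a `C^{n+1}` field is `C^n`. [folklore] -/
private theorem contDiff_jetField {n : ℕ∞} {G : P × E → E} (hG : ContDiff ℝ (n + 1 : ℕ∞) G) :
    ContDiff ℝ n fun q : P × (E × E) =>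
      (G (q.1, q.2.1), fderiv ℝ G (q.1, q.2.1) ((0 : P), q.2.2)) := by
  have hpr : ContDiff ℝ n fun q : P × (E × E) => ((q.1, q.2.1) : P × E) :=
    contDiff_fst.prodMk (contDiff_fst.comp contDiff_snd)
  have hdir : ContDiff ℝ n fun q : P × (E × E) => (((0 : P), q.2.2) : P × E) :=
    contDiff_const.prodMk (contDiff_snd.comp contDiff_snd)
  have hn1 : (n : WithTop ℕ∞) + 1 ≤ ((n + 1 : ℕ∞) : WithTop ℕ∞) := by
    exact le_of_eq (by push_cast; rfl)
  have h2 : ContDiff ℝ n fun q : P × (E × E) => fderiv ℝ G (q.1, q.2.1) ((0 : P), q.2.2) :=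
    (hG.contDiff_fderiv_apply hn1).comp (hpr.prodMk hdir)
  exact ((hG.of_le (by exact_mod_cast le_self_add)).comp hpr).prodMk h2

/-- Interval integral of a pair of continuous functions is the pair of the integrals. [folklore] -/
private theorem intervalIntegral_prodMk {f g : ℝ → E} (hf : Continuous f) (hg : Continuous g) (a b : ℝ) :
    ∫ s in a..b, (f s, g s) = (∫ s in a..b, f s, ∫ s in a..b, g s) := by
  have hfg : Continuous fun s => (f s, g s) := hf.prodMk hg
  have h1 := (ContinuousLinearMap.fst ℝ E E).intervalIntegral_comp_comm (hfg.intervalIntegrable (μ := volume) a b)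
  have h2 := (ContinuousLinearMap.snd ℝ E E).intervalIntegral_comp_comm (hfg.intervalIntegrable (μ := volume) a b)
  simp only [ContinuousLinearMap.coe_fst', ContinuousLinearMap.coe_snd'] at h1 h2
  exact Prod.ext h1.symm h2.symm

omit [CompleteSpace P] [CompleteSpace E] in
/-- Uniqueness for the linear equation `u(τ) = δ + ∫₀^τ B(s)(0, u(s))`, `B` continuous (Grönwall). [folklore] -/
private theorem linear_variation_unique {B : ℝ → (P × E →L[ℝ] E)} (hB : Continuous B) {δ : E}
    {u₁ u₂ : C(I, E)}
    (h₁ : ∀ τ : I, u₁ τ = δ + ∫ s in (0:ℝ)..(τ:ℝ), B s ((0 : P), IccExtend zero_le_one u₁ s))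
    (h₂ : ∀ τ : I, u₂ τ = δ + ∫ s in (0:ℝ)..(τ:ℝ), B s ((0 : P), IccExtend zero_le_one u₂ s)) :
    u₁ = u₂ := by
  obtain ⟨A, hA⟩ := (isCompact_Icc (a := (0:ℝ)) (b := 1)).exists_bound_of_continuousOn hB.continuousOn
  have hA0 : 0 ≤ A := (norm_nonneg _).trans (hA 0 (left_mem_Icc.2 zero_le_one))
  set d : ℝ → ℝ := fun t => ‖IccExtend zero_le_one u₁ t - IccExtend zero_le_one u₂ t‖ with hd
  have hdc : Continuous d := ((continuous_IccExtend_coe u₁).sub (continuous_IccExtend_coe u₂)).norm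
  have hint₁ : Continuous fun s => B s ((0 : P), IccExtend zero_le_one u₁ s) :=
    hB.clm_apply (continuous_const.prodMk (continuous_IccExtend_coe u₁))
  have hint₂ : Continuous fun s => B s ((0 : P), IccExtend zero_le_one u₂ s) :=
    hB.clm_apply (continuous_const.prodMk (continuous_IccExtend_coe u₂))
  have hle : ∀ t ∈ Icc (0:ℝ) 1, d t ≤ 0 + ∫ s in (0:ℝ)..t, A * d s := by
    intro t ht
    have hsub : IccExtend zero_le_one u₁ t - IccExtend zero_le_one u₂ t =
        ∫ s in (0:ℝ)..t, (B s ((0 : P), IccExtend zero_le_one u₁ s) - B s ((0 : P), IccExtend zero_le_one u₂ s)) := by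
      rw [IccExtend_of_mem _ _ ht, IccExtend_of_mem _ _ ht, h₁ ⟨t, ht⟩, h₂ ⟨t, ht⟩, add_sub_add_left_eq_sub,
        intervalIntegral.integral_sub (hint₁.intervalIntegrable _ _) (hint₂.intervalIntegrable _ _)]
    rw [zero_add, hd]; simp only
    rw [hsub]
    refine (intervalIntegral.norm_integral_le_integral_norm ht.1).trans ?_
    refine intervalIntegral.integral_mono_on ht.1 ?_ (by exact (continuous_const.mul hdc).intervalIntegrable _ _) ?_
    · exact ((hint₁.sub hint₂).norm).intervalIntegrable _ _
    · intro s hs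
      have hs1 : s ∈ Icc (0:ℝ) 1 := ⟨hs.1, hs.2.trans ht.2⟩
      rw [← map_sub]
      calc ‖B s (((0 : P), IccExtend zero_le_one u₁ s) - ((0 : P), IccExtend zero_le_one u₂ s))‖
          ≤ ‖B s‖ * ‖((0 : P), IccExtend zero_le_one u₁ s) - ((0 : P), IccExtend zero_le_one u₂ s)‖ :=
            (B s).le_opNorm _
        _ ≤ A * d s := by
            refine mul_le_mul (hA s hs1) ?_ (norm_nonneg _) hA0
            simp [hd, Prod.norm_def]
  have key : ∀ T ∈ Icc (0:ℝ) 1, d T ≤ 0 := by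
    intro T hT
    have h := gronwall_integral_le hT.1 continuous_const hdc (fun _ => hA0) monotoneOn_const
      (fun t ht => hle t ⟨ht.1, ht.2.trans hT.2⟩)
    simpa using h
  ext τ
  have h0 : d τ ≤ 0 := key τ τ.2
  have : IccExtend zero_le_one u₁ τ = IccExtend zero_le_one u₂ τ := by
    have h' : ‖IccExtend zero_le_one u₁ τ - IccExtend zero_le_one u₂ τ‖ ≤ 0 := h0
    exact sub_eq_zero.1 (norm_le_zero_iff.1 h')
  rwa [IccExtend_of_mem _ _ τ.2, IccExtend_of_mem _ _ τ.2] at this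

/-! ### The jet family solves the jet system -/

/-- **The jet family `Φ₁(x, δ) = (Φ x, DΦ(x) δ)` is the solution family of the jet system**
(Hartman, Ch. V, Thm. 3.1: the pair (solution, first variation) solves the enlarged system
`(v, w)' = (f(t, v), ∂_v f(t, v) w)`): it satisfies the path-driven integral equation with field
`G₁(p, (v, w)) = (G(p, v), ∂_vG(p, v) w)`, and it is the only continuous solution from each start
`(x, δ)` (uniqueness of `Φ` plus Grönwall for the linear second component).
[cite: Hartman2002, Ch. V Thm. 3.1 (PDF p. 95)] -/
theorem jet_solution_family {n : ℕ∞} {G : P × E → E} (hG : ContDiff ℝ n G) (hn : 1 ≤ n)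
    (c : C(I, P)) {Φ : E → C(I, E)}
    (hΦ : ∀ (x : E) (τ : I), Φ x τ = x + ∫ s in (0:ℝ)..(τ:ℝ),
      G (IccExtend zero_le_one c s, IccExtend zero_le_one (Φ x) s))
    (huniq : ∀ (x : E) (α : C(I, E)), (∀ τ : I, α τ = x + ∫ s in (0:ℝ)..(τ:ℝ),
      G (IccExtend zero_le_one c s, IccExtend zero_le_one α s)) → α = Φ x) :
    (∀ (q : E × E) (τ : I), ((Φ q.1).prodMk (fderiv ℝ Φ q.1 q.2)) τ = q + ∫ s in (0:ℝ)..(τ:ℝ),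
      (fun r : P × (E × E) => (G (r.1, r.2.1), fderiv ℝ G (r.1, r.2.1) ((0 : P), r.2.2)))
        (IccExtend zero_le_one c s, IccExtend zero_le_one ((Φ q.1).prodMk (fderiv ℝ Φ q.1 q.2)) s)) ∧
    (∀ (q : E × E) (α : C(I, E × E)), (∀ τ : I, α τ = q + ∫ s in (0:ℝ)..(τ:ℝ),
      (fun r : P × (E × E) => (G (r.1, r.2.1), fderiv ℝ G (r.1, r.2.1) ((0 : P), r.2.2)))
        (IccExtend zero_le_one c s, IccExtend zero_le_one α s)) →
      α = (Φ q.1).prodMk (fderiv ℝ Φ q.1 q.2)) := by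
  have hn0 : (n : WithTop ℕ∞) ≠ 0 := by
    have : n ≠ 0 := by rintro rfl; exact absurd hn (by simp)
    exact_mod_cast this
  have hGc : Continuous G := hG.continuous
  have hG'c : Continuous (fderiv ℝ G) := hG.continuous_fderiv hn0
  have hc1 : ∀ α : C(I, E), Continuous fun s : ℝ =>
      G (IccExtend zero_le_one c s, IccExtend zero_le_one α s) := fun α =>
    hGc.comp ((continuous_IccExtend_coe c).prodMk (continuous_IccExtend_coe α))
  have hc2 : ∀ α w : C(I, E), Continuous fun s : ℝ =>
      fderiv ℝ G (IccExtend zero_le_one c s, IccExtend zero_le_one α s)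
        ((0 : P), IccExtend zero_le_one w s) := fun α w =>
    (hG'c.comp ((continuous_IccExtend_coe c).prodMk (continuous_IccExtend_coe α))).clm_apply
      (continuous_const.prodMk (continuous_IccExtend_coe w))
  have hsplit : ∀ (α w : C(I, E)) (s : ℝ),
      (fun r : P × (E × E) => (G (r.1, r.2.1), fderiv ℝ G (r.1, r.2.1) ((0 : P), r.2.2)))
        (IccExtend zero_le_one c s, IccExtend zero_le_one (α.prodMk w) s) =
      (G (IccExtend zero_le_one c s, IccExtend zero_le_one α s),
        fderiv ℝ G (IccExtend zero_le_one c s, IccExtend zero_le_one α s)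
          ((0 : P), IccExtend zero_le_one w s)) := fun α w s => rfl
  refine ⟨fun q τ => ?_, fun q α hα => ?_⟩
  · simp_rw [hsplit, intervalIntegral_prodMk (hc1 (Φ q.1)) (hc2 (Φ q.1) (fderiv ℝ Φ q.1 q.2))]
    refine Prod.ext ?_ ?_
    · simpa using hΦ q.1 τ
    · simpa using fderiv_pathDriven_solution_family_apply hG hn c hΦ huniq q.1 q.2 τ
  · -- components of `α`
    set α₁ : C(I, E) := ((ContinuousLinearMap.fst ℝ E E).compLeftContinuous ℝ I) α with hα₁
    set α₂ : C(I, E) := ((ContinuousLinearMap.snd ℝ E E).compLeftContinuous ℝ I) α with hα₂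
    have hαeq : α = α₁.prodMk α₂ := by ext τ <;> rfl
    rw [hαeq] at hα
    simp_rw [hsplit, intervalIntegral_prodMk (hc1 α₁) (hc2 α₁ α₂)] at hα
    have h1 : ∀ τ : I, α₁ τ = q.1 + ∫ s in (0:ℝ)..(τ:ℝ),
        G (IccExtend zero_le_one c s, IccExtend zero_le_one α₁ s) := fun τ => by
      simpa using congrArg Prod.fst (hα τ)
    have hα₁Φ : α₁ = Φ q.1 := huniq q.1 α₁ h1
    have h2 : ∀ τ : I, α₂ τ = q.2 + ∫ s in (0:ℝ)..(τ:ℝ),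
        fderiv ℝ G (IccExtend zero_le_one c s, IccExtend zero_le_one (Φ q.1) s)
          ((0 : P), IccExtend zero_le_one α₂ s) := fun τ => by
      have := congrArg Prod.snd (hα τ)
      rw [hα₁Φ] at this
      simpa using this
    have hw : ∀ τ : I, fderiv ℝ Φ q.1 q.2 τ = q.2 + ∫ s in (0:ℝ)..(τ:ℝ),
        fderiv ℝ G (IccExtend zero_le_one c s, IccExtend zero_le_one (Φ q.1) s)
          ((0 : P), IccExtend zero_le_one (fderiv ℝ Φ q.1 q.2) s) :=
      fun τ => fderiv_pathDriven_solution_family_apply hG hn c hΦ huniq q.1 q.2 τ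
    have hB : Continuous fun s : ℝ => fderiv ℝ G (IccExtend zero_le_one c s, IccExtend zero_le_one (Φ q.1) s) :=
      hG'c.comp ((continuous_IccExtend_coe c).prodMk (continuous_IccExtend_coe (Φ q.1)))
    have hα₂w : α₂ = fderiv ℝ Φ q.1 q.2 := linear_variation_unique hB h2 hw
    rw [hαeq, hα₁Φ, hα₂w]

/-- **The jet family is `C^n`** in `(x, δ)` when `G` is `C^{n+1}` (the first-order theorem applied to
the jet system). [cite: Hartman2002, Ch. V Cor. 4.1 (PDF p. 100)] -/
theorem contDiff_jet_solution_family {n : ℕ∞} {G : P × E → E} (hG : ContDiff ℝ (n + 1 : ℕ∞) G)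
    (hn : 1 ≤ n) (c : C(I, P)) {Φ : E → C(I, E)}
    (hΦ : ∀ (x : E) (τ : I), Φ x τ = x + ∫ s in (0:ℝ)..(τ:ℝ),
      G (IccExtend zero_le_one c s, IccExtend zero_le_one (Φ x) s))
    (huniq : ∀ (x : E) (α : C(I, E)), (∀ τ : I, α τ = x + ∫ s in (0:ℝ)..(τ:ℝ),
      G (IccExtend zero_le_one c s, IccExtend zero_le_one α s)) → α = Φ x) :
    ContDiff ℝ n fun q : E × E => (Φ q.1).prodMk (fderiv ℝ Φ q.1 q.2) := by
  have hG' : ContDiff ℝ n G := hG.of_le (by exact_mod_cast le_self_add)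
  obtain ⟨h1, h2⟩ := jet_solution_family hG' hn c hΦ huniq
  exact contDiff_pathDriven_solution_family (contDiff_jetField hG) hn c
    (Φ := fun q : E × E => (Φ q.1).prodMk (fderiv ℝ Φ q.1 q.2)) h1 h2

/-! ### Grönwall for the jet system: second-order bounds -/

omit [CompleteSpace P] [CompleteSpace E] in
/-- `DG₁(p,(v,w))(0,(dv,dw)) = (∂_vG dv, ∂_vG dw + ∂²_{vv}G(dv, w))`. [folklore] -/
private theorem fderiv_jetField_apply {n : ℕ∞} {G : P × E → E} (hG : ContDiff ℝ (n + 1 : ℕ∞) G)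
    (hn : 1 ≤ n) (p : P) (v w dv dw : E) :
    fderiv ℝ (fun r : P × (E × E) => (G (r.1, r.2.1), fderiv ℝ G (r.1, r.2.1) ((0 : P), r.2.2)))
        (p, (v, w)) ((0 : P), (dv, dw)) =
      (fderiv ℝ G (p, v) ((0 : P), dv),
        fderiv ℝ G (p, v) ((0 : P), dw) + fderiv ℝ (fderiv ℝ G) (p, v) ((0 : P), dv) ((0 : P), w)) := by
  have h2 : (2 : WithTop ℕ∞) ≤ ((n + 1 : ℕ∞) : WithTop ℕ∞) := by
    have h' : (1 : ℕ∞) + 1 ≤ n + 1 := by gcongr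
    have h'' : ((1 + 1 : ℕ∞) : WithTop ℕ∞) ≤ ((n + 1 : ℕ∞) : WithTop ℕ∞) := by exact_mod_cast h'
    have h2eq : (2 : WithTop ℕ∞) = ((1 + 1 : ℕ∞) : WithTop ℕ∞) := by norm_num
    rw [h2eq]; exact h''
  have hGd : Differentiable ℝ G := hG.differentiable (by positivity)
  have hG'd : Differentiable ℝ (fderiv ℝ G) :=
    (hG.fderiv_right (m := 1) (by exact h2)).differentiable one_ne_zero
  let πL : P × (E × E) →L[ℝ] P × E :=
    (ContinuousLinearMap.fst ℝ P (E × E)).prod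
      ((ContinuousLinearMap.fst ℝ E E).comp (ContinuousLinearMap.snd ℝ P (E × E)))
  let ιL : P × (E × E) →L[ℝ] P × E :=
    (ContinuousLinearMap.inr ℝ P E).comp
      ((ContinuousLinearMap.snd ℝ E E).comp (ContinuousLinearMap.snd ℝ P (E × E)))
  have hπf : (fun r : P × (E × E) => ((r.1, r.2.1) : P × E)) = πL := by funext r; rfl
  have hιf : (fun r : P × (E × E) => (((0 : P), r.2.2) : P × E)) = ιL := by
    funext r; simp [ιL]
  have hπ : HasFDerivAt (fun r : P × (E × E) => ((r.1, r.2.1) : P × E)) πL (p, (v, w)) := by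
    rw [hπf]; exact πL.hasFDerivAt
  have hι : HasFDerivAt (fun r : P × (E × E) => (((0 : P), r.2.2) : P × E)) ιL (p, (v, w)) := by
    rw [hιf]; exact ιL.hasFDerivAt
  have hA : HasFDerivAt (fun r : P × (E × E) => G (r.1, r.2.1)) ((fderiv ℝ G (p, v)).comp πL) (p, (v, w)) :=
    (hGd (p, v)).hasFDerivAt.comp (p, (v, w)) hπ
  have hc : HasFDerivAt (fun r : P × (E × E) => fderiv ℝ G (r.1, r.2.1))
      ((fderiv ℝ (fderiv ℝ G) (p, v)).comp πL) (p, (v, w)) :=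
    (hG'd (p, v)).hasFDerivAt.comp (p, (v, w)) hπ
  have hB := hc.clm_apply hι
  have h := (hA.prodMk hB).fderiv
  rw [h]
  simp [πL, ιL]

/-- **Grönwall for the jet.** If along the solution `Φ x₀` the first and second `v`-derivatives of
the field are bounded, `‖∂_vG(c(s), Φ x₀ (s)) u‖ ≤ A₁‖u‖` and `‖∂²_{vv}G(c(s), Φ x₀ (s))(u, u')‖ ≤ A₂‖u‖‖u'‖`,
then the derivative of the jet family `(x, δ) ↦ (Φ x τ, DΦ(x) δ τ)` at `(x₀, δ₀)` has norm at most
`exp((A₁ + A₂‖δ₀‖e^{A₁}) τ)` (Hartman, Ch. V, proof of Thm. 3.1: Grönwall for the enlarged system, using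
the first-order bound `‖DΦ(x₀) δ₀ (s)‖ ≤ ‖δ₀‖ e^{A₁ s}`). [cite: Hartman2002, Ch. V Thm. 3.1 (PDF p. 95)] -/
theorem norm_fderiv_jet_solution_family_eval_le {n : ℕ∞} {G : P × E → E} (hG : ContDiff ℝ (n + 1 : ℕ∞) G)
    (hn : 1 ≤ n) (c : C(I, P)) {Φ : E → C(I, E)}
    (hΦ : ∀ (x : E) (τ : I), Φ x τ = x + ∫ s in (0:ℝ)..(τ:ℝ),
      G (IccExtend zero_le_one c s, IccExtend zero_le_one (Φ x) s))
    (huniq : ∀ (x : E) (α : C(I, E)), (∀ τ : I, α τ = x + ∫ s in (0:ℝ)..(τ:ℝ),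
      G (IccExtend zero_le_one c s, IccExtend zero_le_one α s)) → α = Φ x)
    (x₀ δ₀ : E) {A₁ A₂ : ℝ} (hA₁ : 0 ≤ A₁) (hA₂ : 0 ≤ A₂)
    (hb₁ : ∀ (s : I) (u : E), ‖fderiv ℝ G (c s, Φ x₀ s) ((0 : P), u)‖ ≤ A₁ * ‖u‖)
    (hb₂ : ∀ (s : I) (u u' : E),
      ‖fderiv ℝ (fderiv ℝ G) (c s, Φ x₀ s) ((0 : P), u) ((0 : P), u')‖ ≤ A₂ * ‖u‖ * ‖u'‖)
    (τ : I) :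
    ‖fderiv ℝ (fun q : E × E => ((Φ q.1).prodMk (fderiv ℝ Φ q.1 q.2)) τ) (x₀, δ₀)‖ ≤
      Real.exp ((A₁ + A₂ * (‖δ₀‖ * Real.exp A₁)) * τ) := by
  have hG' : ContDiff ℝ n G := hG.of_le (by exact_mod_cast le_self_add)
  obtain ⟨h1, h2⟩ := jet_solution_family hG' hn c hΦ huniq
  have hA : 0 ≤ A₁ + A₂ * (‖δ₀‖ * Real.exp A₁) := by positivity
  have hw : ∀ s : I, ‖fderiv ℝ Φ x₀ δ₀ s‖ ≤ ‖δ₀‖ * Real.exp A₁ := fun s =>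
    (norm_fderiv_pathDriven_solution_family_apply_le hG' hn c hΦ huniq x₀ hA₁ hb₁ δ₀ s).trans (by
      gcongr
      · calc A₁ * (s : ℝ) ≤ A₁ * 1 := by gcongr; exact s.2.2
          _ = A₁ := mul_one _)
  refine norm_fderiv_pathDriven_solution_family_eval_le (contDiff_jetField hG) hn c
    (Φ := fun q : E × E => (Φ q.1).prodMk (fderiv ℝ Φ q.1 q.2)) h1 h2 (x₀, δ₀) hA ?_ τ
  intro s d
  obtain ⟨dv, dw⟩ := d
  have hev : ((fun q : E × E => (Φ q.1).prodMk (fderiv ℝ Φ q.1 q.2)) (x₀, δ₀)) s =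
      (Φ x₀ s, fderiv ℝ Φ x₀ δ₀ s) := rfl
  rw [hev, fderiv_jetField_apply hG hn]
  have hdv : ‖dv‖ ≤ ‖(dv, dw)‖ := by simp [Prod.norm_def]
  have hdw : ‖dw‖ ≤ ‖(dv, dw)‖ := by simp [Prod.norm_def]
  have hK : 0 ≤ A₂ * (‖δ₀‖ * Real.exp A₁) := by positivity
  have e1 : ‖fderiv ℝ G (c s, Φ x₀ s) ((0 : P), dv)‖ ≤ (A₁ + A₂ * (‖δ₀‖ * Real.exp A₁)) * ‖(dv, dw)‖ :=
    calc ‖fderiv ℝ G (c s, Φ x₀ s) ((0 : P), dv)‖ ≤ A₁ * ‖dv‖ := hb₁ s dv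
      _ ≤ A₁ * ‖(dv, dw)‖ := by gcongr
      _ ≤ (A₁ + A₂ * (‖δ₀‖ * Real.exp A₁)) * ‖(dv, dw)‖ :=
          mul_le_mul_of_nonneg_right (le_add_of_nonneg_right hK) (norm_nonneg _)
  have e2 : ‖fderiv ℝ G (c s, Φ x₀ s) ((0 : P), dw) +
      fderiv ℝ (fderiv ℝ G) (c s, Φ x₀ s) ((0 : P), dv) ((0 : P), fderiv ℝ Φ x₀ δ₀ s)‖ ≤
      (A₁ + A₂ * (‖δ₀‖ * Real.exp A₁)) * ‖(dv, dw)‖ := by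
    have t1 : ‖fderiv ℝ G (c s, Φ x₀ s) ((0 : P), dw)‖ ≤ A₁ * ‖(dv, dw)‖ :=
      (hb₁ s dw).trans (by gcongr)
    have t2 : ‖fderiv ℝ (fderiv ℝ G) (c s, Φ x₀ s) ((0 : P), dv) ((0 : P), fderiv ℝ Φ x₀ δ₀ s)‖ ≤
        A₂ * ‖(dv, dw)‖ * (‖δ₀‖ * Real.exp A₁) :=
      (hb₂ s dv (fderiv ℝ Φ x₀ δ₀ s)).trans (by gcongr; exact hw s)
    calc _ ≤ ‖fderiv ℝ G (c s, Φ x₀ s) ((0 : P), dw)‖ +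
          ‖fderiv ℝ (fderiv ℝ G) (c s, Φ x₀ s) ((0 : P), dv) ((0 : P), fderiv ℝ Φ x₀ δ₀ s)‖ := norm_add_le _ _
      _ ≤ A₁ * ‖(dv, dw)‖ + A₂ * ‖(dv, dw)‖ * (‖δ₀‖ * Real.exp A₁) := add_le_add t1 t2
      _ = (A₁ + A₂ * (‖δ₀‖ * Real.exp A₁)) * ‖(dv, dw)‖ := by ring
  rw [Prod.norm_def]
  exact max_le e1 e2

/-- **Second-derivative bound for the path-driven flow.** Under the hypotheses of
`norm_fderiv_jet_solution_family_eval_le`: `‖D²(x ↦ Φ x τ)(x₀)(dx)(δ₀)‖ ≤ exp((A₁ + A₂‖δ₀‖e^{A₁})τ) ‖dx‖`.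
[cite: Hartman2002, Ch. V Thm. 3.1 (PDF p. 95)] -/
theorem norm_fderiv_fderiv_pathDriven_apply_le {n : ℕ∞} {G : P × E → E} (hG : ContDiff ℝ (n + 1 : ℕ∞) G)
    (hn : 1 ≤ n) (c : C(I, P)) {Φ : E → C(I, E)}
    (hΦ : ∀ (x : E) (τ : I), Φ x τ = x + ∫ s in (0:ℝ)..(τ:ℝ),
      G (IccExtend zero_le_one c s, IccExtend zero_le_one (Φ x) s))
    (huniq : ∀ (x : E) (α : C(I, E)), (∀ τ : I, α τ = x + ∫ s in (0:ℝ)..(τ:ℝ),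
      G (IccExtend zero_le_one c s, IccExtend zero_le_one α s)) → α = Φ x)
    (x₀ δ₀ : E) {A₁ A₂ : ℝ} (hA₁ : 0 ≤ A₁) (hA₂ : 0 ≤ A₂)
    (hb₁ : ∀ (s : I) (u : E), ‖fderiv ℝ G (c s, Φ x₀ s) ((0 : P), u)‖ ≤ A₁ * ‖u‖)
    (hb₂ : ∀ (s : I) (u u' : E),
      ‖fderiv ℝ (fderiv ℝ G) (c s, Φ x₀ s) ((0 : P), u) ((0 : P), u')‖ ≤ A₂ * ‖u‖ * ‖u'‖)
    (τ : I) (dx : E) :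
    ‖fderiv ℝ (fderiv ℝ (fun x => Φ x τ)) x₀ dx δ₀‖ ≤
      Real.exp ((A₁ + A₂ * (‖δ₀‖ * Real.exp A₁)) * τ) * ‖dx‖ := by
  have hG' : ContDiff ℝ n G := hG.of_le (by exact_mod_cast le_self_add)
  have hn0 : ((n + 1 : ℕ∞) : WithTop ℕ∞) ≠ 0 := by simp
  have hΦs : ContDiff ℝ (n + 1 : ℕ∞) Φ := contDiff_pathDriven_solution_family hG le_add_self c hΦ huniq
  have hΦτ : ContDiff ℝ (n + 1 : ℕ∞) (fun x => Φ x τ) :=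
    (ContinuousMap.evalCLM ℝ τ (M := E)).contDiff.comp hΦs
  have hΦd : Differentiable ℝ Φ := hΦs.differentiable hn0
  have hcd : Differentiable ℝ (fderiv ℝ (fun x => Φ x τ)) :=
    (hΦτ.fderiv_right (m := n) le_rfl).differentiable (by
      have : n ≠ 0 := by rintro rfl; exact absurd hn (by simp)
      exact_mod_cast this)
  have hjet : ContDiff ℝ n (fun q : E × E => (Φ q.1).prodMk (fderiv ℝ Φ q.1 q.2)) :=
    contDiff_jet_solution_family hG hn c hΦ huniq
  have hjetd : Differentiable ℝ (fun q : E × E => ((Φ q.1).prodMk (fderiv ℝ Φ q.1 q.2)) τ) :=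
    ((ContinuousMap.evalCLM ℝ τ (M := E × E)).contDiff.comp hjet).differentiable (by
      have : n ≠ 0 := by rintro rfl; exact absurd hn (by simp)
      exact_mod_cast this)
  have hΨ : (fun x => fderiv ℝ (fun x => Φ x τ) x δ₀) =
      fun x => (((fun q : E × E => ((Φ q.1).prodMk (fderiv ℝ Φ q.1 q.2)) τ) (x, δ₀)).2) := by
    funext x
    have h : HasFDerivAt (fun x => Φ x τ) ((ContinuousMap.evalCLM ℝ τ (M := E)).comp (fderiv ℝ Φ x)) x :=
      (ContinuousMap.evalCLM ℝ τ (M := E)).hasFDerivAt.comp x (hΦd x).hasFDerivAt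
    show fderiv ℝ (fun x => Φ x τ) x δ₀ = (fderiv ℝ Φ x δ₀) τ
    rw [h.fderiv]; rfl
  have hcomp : HasFDerivAt (fun x => (((fun q : E × E => ((Φ q.1).prodMk (fderiv ℝ Φ q.1 q.2)) τ) (x, δ₀)).2))
      ((ContinuousLinearMap.snd ℝ E E).comp
        ((fderiv ℝ (fun q : E × E => ((Φ q.1).prodMk (fderiv ℝ Φ q.1 q.2)) τ) (x₀, δ₀)).comp
          (ContinuousLinearMap.inl ℝ E E))) x₀ := by
    have hin : HasFDerivAt (fun x : E => (x, δ₀)) (ContinuousLinearMap.inl ℝ E E) x₀ :=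
      hasFDerivAt_prodMk_left (𝕜 := ℝ) x₀ δ₀
    exact (ContinuousLinearMap.snd ℝ E E).hasFDerivAt.comp x₀ (((hjetd (x₀, δ₀)).hasFDerivAt).comp x₀ hin)
  have hclm : fderiv ℝ (fun x => fderiv ℝ (fun x => Φ x τ) x δ₀) x₀ dx =
      fderiv ℝ (fderiv ℝ (fun x => Φ x τ)) x₀ dx δ₀ := by
    rw [fderiv_clm_apply (hcd x₀) (differentiableAt_const δ₀)]
    simp
  rw [← hclm, hΨ, hcomp.fderiv]
  calc ‖((ContinuousLinearMap.snd ℝ E E).comp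
          ((fderiv ℝ (fun q : E × E => ((Φ q.1).prodMk (fderiv ℝ Φ q.1 q.2)) τ) (x₀, δ₀)).comp
            (ContinuousLinearMap.inl ℝ E E))) dx‖
      = ‖(fderiv ℝ (fun q : E × E => ((Φ q.1).prodMk (fderiv ℝ Φ q.1 q.2)) τ) (x₀, δ₀) (dx, 0)).2‖ := by
        simp
    _ ≤ ‖fderiv ℝ (fun q : E × E => ((Φ q.1).prodMk (fderiv ℝ Φ q.1 q.2)) τ) (x₀, δ₀) (dx, 0)‖ := by
        simp [Prod.norm_def]
    _ ≤ ‖fderiv ℝ (fun q : E × E => ((Φ q.1).prodMk (fderiv ℝ Φ q.1 q.2)) τ) (x₀, δ₀)‖ * ‖((dx, (0 : E)) : E × E)‖ :=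
        ContinuousLinearMap.le_opNorm _ _
    _ ≤ Real.exp ((A₁ + A₂ * (‖δ₀‖ * Real.exp A₁)) * τ) * ‖dx‖ := by
        have h0 : ‖((dx, (0 : E)) : E × E)‖ = ‖dx‖ := by simp [Prod.norm_def]
        rw [h0]
        exact mul_le_mul_of_nonneg_right
          (norm_fderiv_jet_solution_family_eval_le hG hn c hΦ huniq x₀ δ₀ hA₁ hA₂ hb₁ hb₂ τ) (norm_nonneg _)

/-- **Operator-norm form**: `‖D²(x ↦ Φ x τ)(x₀)‖ ≤ exp((A₁ + A₂ e^{A₁}) τ)`, a bound depending only on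
derivative bounds of the field along the solution, not on the driving path.
[cite: Hartman2002, Ch. V Thm. 3.1 (PDF p. 95)] -/
theorem norm_fderiv_fderiv_pathDriven_le {n : ℕ∞} {G : P × E → E} (hG : ContDiff ℝ (n + 1 : ℕ∞) G)
    (hn : 1 ≤ n) (c : C(I, P)) {Φ : E → C(I, E)}
    (hΦ : ∀ (x : E) (τ : I), Φ x τ = x + ∫ s in (0:ℝ)..(τ:ℝ),
      G (IccExtend zero_le_one c s, IccExtend zero_le_one (Φ x) s))
    (huniq : ∀ (x : E) (α : C(I, E)), (∀ τ : I, α τ = x + ∫ s in (0:ℝ)..(τ:ℝ),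
      G (IccExtend zero_le_one c s, IccExtend zero_le_one α s)) → α = Φ x)
    (x₀ : E) {A₁ A₂ : ℝ} (hA₁ : 0 ≤ A₁) (hA₂ : 0 ≤ A₂)
    (hb₁ : ∀ (s : I) (u : E), ‖fderiv ℝ G (c s, Φ x₀ s) ((0 : P), u)‖ ≤ A₁ * ‖u‖)
    (hb₂ : ∀ (s : I) (u u' : E),
      ‖fderiv ℝ (fderiv ℝ G) (c s, Φ x₀ s) ((0 : P), u) ((0 : P), u')‖ ≤ A₂ * ‖u‖ * ‖u'‖)
    (τ : I) :
    ‖fderiv ℝ (fderiv ℝ (fun x => Φ x τ)) x₀‖ ≤ Real.exp ((A₁ + A₂ * Real.exp A₁) * τ) := by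
  refine ContinuousLinearMap.opNorm_le_bound _ (Real.exp_pos _).le fun dx => ?_
  refine ContinuousLinearMap.opNorm_le_bound _ (by positivity) fun δ => ?_
  by_cases hδ : δ = 0
  · subst hδ; simp
  · have hδn : ‖δ‖ ≠ 0 := norm_ne_zero_iff.2 hδ
    set δ₀ : E := ‖δ‖⁻¹ • δ with hδ₀
    have hδ₀n : ‖δ₀‖ = 1 := by rw [hδ₀, norm_smul, norm_inv, norm_norm, inv_mul_cancel₀ hδn]
    have hδeq : δ = ‖δ‖ • δ₀ := by rw [hδ₀, smul_smul, mul_inv_cancel₀ hδn, one_smul]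
    have h := norm_fderiv_fderiv_pathDriven_apply_le hG hn c hΦ huniq x₀ δ₀ hA₁ hA₂ hb₁ hb₂ τ dx
    rw [hδ₀n, one_mul] at h
    have hval : fderiv ℝ (fderiv ℝ (fun x => Φ x τ)) x₀ dx δ =
        ‖δ‖ • fderiv ℝ (fderiv ℝ (fun x => Φ x τ)) x₀ dx δ₀ := by
      conv_lhs => rw [hδeq]
      rw [map_smul]
    rw [hval, norm_smul, norm_norm]
    calc ‖δ‖ * ‖fderiv ℝ (fderiv ℝ (fun x => Φ x τ)) x₀ dx δ₀‖
        ≤ ‖δ‖ * (Real.exp ((A₁ + A₂ * Real.exp A₁) * τ) * ‖dx‖) :=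
          mul_le_mul_of_nonneg_left h (norm_nonneg _)
      _ = Real.exp ((A₁ + A₂ * Real.exp A₁) * τ) * ‖dx‖ * ‖δ‖ := by ring
end Jet
end Literature.Analysis.ODE
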